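import Summits.HodgeConjecture.HodgeConjecture.Theorems.F0P3bPNullIrreducible
import Summits.HodgeConjecture.HodgeConjecture.Theorems.F0P3bStubT3jCocycleValuesPNull
import Literature.NumberTheory.Automorphic.GKModules
import HarnessLib

/-!
# FLOOR-0 P3b «ENGINE local packets», line `F0_EngineLocalPackets` — STUB T6a CLOSED: purity of degree-one
# `(𝔤, K)`-cohomology for EVERY irreducible `(𝔤, K)`-module of `U(α, β)` (no unitarity, no classification)

Cell hodgecm-mathlib (D-0151), FLOOR 0, crux item H413 = stmt-HodgeConjecture-24833; sub-line
`Cruxes/H413/Lines/F0_EngineLocalPackets.lean` (F0P3b-plan, ed. 1 808dda7d), registered stub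
`stub_T6a_degOneTypePure : StubT6aDegOneTypePure` (§2 there).  PROOF lane (theorems only); author F0P3-p01 (g2).
The Lines module is NOT importable into Theorems (it carries the open `sorry`s) and its hypothesis bundle
`IsCohUnitaryIrrep` is Lines-local, so the closer `stubT6a_holds` is stated with the body of `StubT6aDegOneTypePure`
VERBATIM except that the bundle `(h : IsCohUnitaryIrrep ρK ρ𝔤)` is replaced by the two of its four fields that are used,
`(hGK : IsGKModule _ ρK ρ𝔤) (hirr : IsIrreducibleGK ρK ρ𝔤)` (and `h.gk.ad_compat ↦ hGK.ad_compat`); the edition-2 fold is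
`theorem stub_T6a_degOneTypePure : StubT6aDegOneTypePure := fun V _ _ ρK ρ𝔤 h => stubT6a_holds V ρK ρ𝔤 h.gk h.irred`.
Unitarity (`h.unit`) and admissibility (`h.adm`) are NOT used: purity holds for every irreducible `(𝔤, K)`-module of
every `U(α, β)` (`typeClasses_one_eq_bot_or`).

THE PROOF ([BorelWallach2000, II §4.1–4.2]; [Rogawski1990, §15.2]; [VoganZuckerman1984, §5] for the classical
statement).  A non-zero class in `H¹_δ` (`δ = ±1`) is represented by a non-zero CLOSED `(𝔤, K)`-1-cochain `f` of type
`δ`; its values are `𝔭^{−δ}`-null (★ T3j `stubT3j_holds`) `z₀`-weight vectors of weight `δ i` (★ `mem_upqType_iff`), i.e.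
lie in the null weight space `T_{δi}(δi)` of ★ `F0P3bPNullIrreducible`.  If `H¹_{+1} ≠ 0`, irreducibility and the
generation lemma (`exists_eq_add_nat_mul_of_nullWeightSpace_ne_bot`) pin the `z₀`-spectrum of `V` to `{i(n+1) | n ∈ ℕ}`;
a non-zero class in `H¹_{−1}` would produce a `z₀`-eigenvector of weight `−i`, and `−i = i(n+1)` is impossible.

HONEST LABEL: HC_CM is proved only modulo the printed citations until rung 0 closes; this file discharges none of them.
-/

-- Mathlib idiom (as in `GKModules`, `GKCohomology`, the `Upq*` files and the Lines file): commutator bracket on `Module.End`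
attribute [local instance 100] LieRing.ofAssociativeRing

set_option autoImplicit false
set_option linter.dupNamespace false

noncomputable section

namespace Summit.HodgeConjecture.HodgeConjecture.Cruxes.H413.F0P3bStubT6aDegOneTypePure

open Literature.Algebra.Lie Literature.Algebra.Lie.ChevalleyEilenberg
open Literature.NumberTheory.Automorphic
open Literature.RepresentationTheory.BorelWallach2000
open Literature.RepresentationTheory.KonnoKonno2007 Literature.RepresentationTheory.KonnoKonno2007.RealDualPair
open Literature.RepresentationTheory.KonnoKonno2007.RealDualPair.UForm
open Summit.HodgeConjecture.HodgeConjecture.Cruxes.H413.F0P3bPPartOperators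
open Summit.HodgeConjecture.HodgeConjecture.Cruxes.H413.F0P3bPNullGeneration
open Summit.HodgeConjecture.HodgeConjecture.Cruxes.H413.F0P3bPNullIrreducible
open Summit.HodgeConjecture.HodgeConjecture.Cruxes.H413.F0P3bStubT3jCocycleValuesPNull

variable {α β : Type} [Fintype α] [DecidableEq α] [Fintype β] [DecidableEq β]
  {V : Type} [AddCommGroup V] [Module ℂ V]
  (ρK : Representation ℂ (uFormGroup α β).maximalCompact V)
  (ρ𝔤 : (uFormGroup α β).lie →ₗ⁅ℝ⁆ Module.End ℂ V)
  (hV : ∀ (k : (uFormGroup α β).maximalCompact) (X : (uFormGroup α β).lie), ρK k ∘ₗ ρ𝔤 X ∘ₗ ρK k⁻¹ =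
    ρ𝔤 ((uFormGroup α β).Ad (Subgroup.inclusion (uFormGroup α β).maximalCompact_le_carrier k) X))

/-! ## §1 From closed cochains of type `δ` to the null weight space `T_{δi}(δi)` -/

/-- `(δ i)² = −1` for `δ² = 1`. [folklore] -/
theorem deltaI_mul_deltaI {δ : ℤ} (hδ : δ * δ = 1) : ((δ : ℂ) * Complex.I) * ((δ : ℂ) * Complex.I) = -1 := by
  have hδC : (δ : ℂ) * (δ : ℂ) = 1 := by exact_mod_cast hδ
  rw [mul_mul_mul_comm, hδC, Complex.I_mul_I, one_mul]

include hV in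
/-- **The values of a closed `(𝔤, K)`-1-cochain of type `δ` (`δ² = 1`) lie in the null weight space `T_{δi}(δi)`**
(★ T3j for the nullity, ★ `mem_upqType_iff` for the weight). [cite: BorelWallach2000, II §4.2 (3)] -/
theorem apply_mem_nullWeightSpace {δ : ℤ} (hδ : δ * δ = 1)
    (f : Cochain ℝ (uFormGroup α β).lie (GKCarrier (uFormGroup α β) ρ𝔤) 1) (hf : f ∈ upqType ρK ρ𝔤 hV 1 δ)
    (hd : d ℝ (uFormGroup α β).lie (GKCarrier (uFormGroup α β) ρ𝔤) 1 f = 0) (Y : Fin 1 → (uFormGroup α β).lie) :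
    (f Y : V) ∈ nullWeightSpace ρ𝔤 ((δ : ℂ) * Complex.I) ((δ : ℂ) * Complex.I) := by
  refine (mem_nullWeightSpace_iff ρ𝔤 _ _ _).2 ⟨fun s => ?_, ((mem_upqType_iff ρK ρ𝔤 hV 1 δ f).1 hf).2 Y⟩
  exact stubT3j_holds α β V ρK ρ𝔤 hV δ hδ f hf hd Y s

include hV in
/-- **A non-zero type-`δ` piece of `H¹` makes `T_{δi}(δi)` non-zero**: a non-zero class is represented by a non-zero
closed cochain of type `δ`, which has a non-zero value. [cite: BorelWallach2000, II §4.2 (3), Thm. 4.8] -/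
theorem nullWeightSpace_ne_bot_of_typeClasses_ne_bot {δ : ℤ} (hδ : δ * δ = 1)
    (h : upqTypeClasses ρK ρ𝔤 hV 1 δ ≠ ⊥) :
    nullWeightSpace ρ𝔤 ((δ : ℂ) * Complex.I) ((δ : ℂ) * Complex.I) ≠ ⊥ := by
  obtain ⟨x, hx, hx0⟩ := (Submodule.ne_bot_iff _).1 h
  obtain ⟨z, hz, rfl⟩ := Submodule.mem_map.1 hx
  have hzt : (z : Cochain ℝ (uFormGroup α β).lie (GKCarrier (uFormGroup α β) ρ𝔤) 1) ∈ upqType ρK ρ𝔤 hV 1 δ :=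
    Submodule.mem_comap.1 hz
  obtain ⟨-, hzd⟩ := ((gkComplex (uFormGroup α β) ρK ρ𝔤 hV).mem_cocycles_iff 1 _).1 z.2
  have hz0 : (z : Cochain ℝ (uFormGroup α β).lie (GKCarrier (uFormGroup α β) ρ𝔤) 1) ≠ 0 := by
    intro h0
    apply hx0
    have : z = 0 := Subtype.ext h0
    rw [this, map_zero]
  obtain ⟨Y, hY⟩ : ∃ Y : Fin 1 → (uFormGroup α β).lie,
      (z : Cochain ℝ (uFormGroup α β).lie (GKCarrier (uFormGroup α β) ρ𝔤) 1) Y ≠ 0 := by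
    by_contra hall
    simp only [not_exists, not_not] at hall
    exact hz0 (AlternatingMap.ext hall)
  exact (Submodule.ne_bot_iff _).2 ⟨_, apply_mem_nullWeightSpace ρK ρ𝔤 hV hδ _ hzt hzd Y, hY⟩

include hV in
/-- A non-zero type-`δ` piece of `H¹` makes the `z₀`-eigenspace of weight `δ i` non-zero.
[cite: BorelWallach2000, II §4.2 (3)] -/
theorem eigenspace_ne_bot_of_typeClasses_ne_bot {δ : ℤ} (hδ : δ * δ = 1)
    (h : upqTypeClasses ρK ρ𝔤 hV 1 δ ≠ ⊥) :
    Module.End.eigenspace (ρ𝔤 (upqZ0 α β)) ((δ : ℂ) * Complex.I) ≠ ⊥ := fun h0 =>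
  nullWeightSpace_ne_bot_of_typeClasses_ne_bot ρK ρ𝔤 hV hδ h
    (eq_bot_iff.2 (h0 ▸ (inf_le_right : nullWeightSpace ρ𝔤 ((δ : ℂ) * Complex.I) ((δ : ℂ) * Complex.I) ≤ _)))

/-! ## §2 Purity for every irreducible `(𝔤, K)`-module of `U(α, β)` -/

include hV in
/-- **Purity of `H¹` (general `U(α, β)`)**: an irreducible `(𝔤, K)`-module of `U(α, β)` has `H¹_{+1} = 0` or
`H¹_{−1} = 0` — a non-zero `H¹_{+1}` pins the `z₀`-spectrum to `{i(n+1)}`, which misses the weight `−i` of a type-`(0,1)`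
class. [cite: BorelWallach2000, VI Thm. 4.11; Rogawski1990, Prop. 15.2.1 (b); VoganZuckerman1984, Thm. 5.6] -/
theorem typeClasses_one_eq_bot_or (hirr : IsIrreducibleGK ρK ρ𝔤) :
    upqTypeClasses ρK ρ𝔤 hV 1 1 = ⊥ ∨ upqTypeClasses ρK ρ𝔤 hV 1 (-1) = ⊥ := by
  by_contra hcon
  rw [not_or] at hcon
  obtain ⟨h1, h2⟩ := hcon
  have hμ : (((1 : ℤ) : ℂ) * Complex.I) * (((1 : ℤ) : ℂ) * Complex.I) = -1 := deltaI_mul_deltaI (by norm_num)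
  have hT := nullWeightSpace_ne_bot_of_typeClasses_ne_bot ρK ρ𝔤 hV (δ := 1) (by norm_num) h1
  have hE := eigenspace_ne_bot_of_typeClasses_ne_bot ρK ρ𝔤 hV (δ := -1) (by norm_num) h2
  obtain ⟨n, hn⟩ := exists_eq_add_nat_mul_of_nullWeightSpace_ne_bot hirr hV hμ hT _ hE
  push_cast at hn
  have e : ((n : ℂ) + 2) * Complex.I = 0 := by linear_combination (-1 : ℂ) * hn
  rcases mul_eq_zero.1 e with h0 | h0
  · have : ((n + 2 : ℕ) : ℂ) ≠ 0 := Nat.cast_ne_zero.2 (by omega)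
    exact this (by push_cast; exact h0)
  · exact Complex.I_ne_zero h0

/-! ## §3 The registered stub T6a of `Lines/F0_EngineLocalPackets.lean` -/

/-- **Stub T6a of `Lines/F0_EngineLocalPackets.lean`, proved** (body of `StubT6aDegOneTypePure` with the Lines-local
bundle `IsCohUnitaryIrrep` replaced by its two used fields `gk`, `irred`): an irreducible `(𝔤, K)`-module of `U(2,1)`
does not carry both Hodge types in degree one, `H¹_{+1}(V) = 0 ∨ H¹_{−1}(V) = 0`.
[cite: BorelWallach2000, VI Thm. 4.11; Rogawski1990, Prop. 15.2.1 (b)] -/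
theorem stubT6a_holds :
    ∀ (V : Type) [AddCommGroup V] [Module ℂ V]
      (ρK : Representation ℂ (uFormGroup (Fin 2) (Fin 1)).maximalCompact V)
      (ρ𝔤 : (uFormGroup (Fin 2) (Fin 1)).lie →ₗ⁅ℝ⁆ Module.End ℂ V)
      (hGK : IsGKModule (uFormGroup (Fin 2) (Fin 1)) ρK ρ𝔤) (hirr : IsIrreducibleGK ρK ρ𝔤),
      upqTypeClasses ρK ρ𝔤 hGK.ad_compat 1 1 = ⊥ ∨ upqTypeClasses ρK ρ𝔤 hGK.ad_compat 1 (-1) = ⊥ :=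
  fun _ _ _ ρK ρ𝔤 hGK hirr => typeClasses_one_eq_bot_or ρK ρ𝔤 hGK.ad_compat hirr

end Summit.HodgeConjecture.HodgeConjecture.Cruxes.H413.F0P3bStubT6aDegOneTypePure

end
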